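import Summits.ResolutionOfSingularities.ResolutionOfSingularities.Theorems.PurelyInseparableDim4Target
import Literature.AlgebraicGeometry.Resolution.CentreBlowupOrdAlongBasics
import Literature.AlgebraicGeometry.Resolution.CentreBlowupMohStability
import Literature.AlgebraicGeometry.Resolution.OrdZeroBasics
import Mathlib.Data.Nat.Choose.Sum
import HarnessLib

/-!
# The ANTELOPE CYLINDER FAMILY `x·y·(x+y)^{2k}` (Z34 / J-S1x): a kangaroo-class C1 rise `2k → 2k+1` for every `k ≥ 1`

[OURS · census certificate, parametric · counted 0.]  Census cell «res-dim4-pi» (D-0157 DOOR 2),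
TY-4 series (res-dim4-p-4).  The desk's STANDING SENTENCE (WORDS #28 (c), #29 (f), #30 (d), zoo row
Z34): at `L = 6` on `S-1a ∪ S-1x` (83,002 configurations, `p = 2`, MODE 1h) every kangaroo-class rise is
a cylinder over a printed surface kangaroo, the C1 parents being the 12 shapes
`x_a·x_b·v·(x_a + u·x_b)^{2k}` (`u, v` units, `r = (1,1)`) — Hauser's antelope.  This file proves the
shape class with `u = v = 1` as ONE theorem for ALL `k ≥ 1` over every field of characteristic `2`
(variables `(x, y, ·, ·) = Fin 4`, `q = 2`):

the state `a k = (F_k = x·y·(x² + y²)^k (= x·y·(x+y)^{2k}), r = (x ↦ 1, y ↦ 1), exc = {x, y})` has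
shade `2k`; the plane `V(z, x, y)` is its MODE-1h centre (`ord_{(x,y)} F_k = 2k + 2`, no coordinate
hyperplane is `2`-fold) AND satisfies Hauser–Perlega's condition (2) (`1 + 1 + 2k ≤ 2k + 2`, eclass
C1); at the point `y = 1` of the `x`-chart the transform is `x^{2k}(y+1)(1 + (y+1)²)^k = x^{2k}(y+1)y^{2k}`
(characteristic `2`), cleaning deletes the square `x^{2k}y^{2k}`, `y` is lost and `x ↦ 2k`:
`k_state k = (x^{2k}y^{2k+1}, (x ↦ 2k), {x})` of shade `(4k+1) − 2k = 2k + 1` — **RISE:d `2k → 2k+1`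
(Moh's `+p^{e−1} = +1`) on a `Step1h`/`StepHP` edge, for every `k ≥ 1`** (`k = 1` is J-003's edge
`yz³ + y³z ⟶ y²z³` up to renaming).  Everything is derived from the binomial expansion
`F_k = Σ_m C(k,m)·x^{2m+1}y^{2(k−m)+1}` (Mathlib `add_pow`).  Nothing here proves or disproves
resolution of singularities in dim ≥ 4 / char p.
-/

-- house layout `Summits/<Summit>/<Problem>` doubles the namespace component (as in the Target file)
set_option linter.dupNamespace false

noncomputable section

namespace Summit.ResolutionOfSingularities.ResolutionOfSingularities.Theorems.PIDim4

namespace AntelopeFamily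

open MvPolynomial Finset
open Literature.AlgebraicGeometry.Resolution
open Literature.AlgebraicGeometry.Resolution.Hauser2010
open Literature.AlgebraicGeometry.Resolution.CentreBlowup

variable {K : Type} [Field K]

/-! ## 1. The polynomials as binomial sums -/

/-- the exponent of `x^α y^β`. [folklore] -/
def xy (α β : ℕ) : Fin 4 →₀ ℕ := Finsupp.single 0 α + Finsupp.single 1 β

/-- `xy α β` coordinatewise. [folklore] -/
@[simp] theorem xy_apply (α β : ℕ) (i : Fin 4) : xy α β i = ![α, β, 0, 0] i := by
  fin_cases i <;> simp [xy]

/-- total degree of `x^α y^β`. [folklore] -/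
theorem degree_xy (α β : ℕ) : (xy α β).degree = α + β := by
  rw [Finsupp.degree_eq_sum, Fin.sum_univ_four]; simp

/-- `x^α y^β` as a product of powers. [folklore] -/
theorem monomial_xy (α β : ℕ) (c : K) :
    (monomial (xy α β) c : MvPolynomial (Fin 4) K) = C c * X 0 ^ α * X 1 ^ β := by
  rw [X_pow_eq_monomial, X_pow_eq_monomial, C_mul_monomial, monomial_mul, mul_one, mul_one]; rfl

variable (K) in
/-- `F_k = x·y·(x² + y²)^k` (`= x·y·(x+y)^{2k}` in characteristic `2`): the antelope cylinder. [folklore] -/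
def F (k : ℕ) : MvPolynomial (Fin 4) K := X 0 * X 1 * (X 0 ^ 2 + X 1 ^ 2) ^ k

/-- **binomial expansion**: `F_k = Σ_{m ≤ k} C(k,m) · x^{2m+1} y^{2(k−m)+1}`. [folklore] -/
theorem F_eq_sum (k : ℕ) :
    F K k = ∑ m ∈ range (k + 1), monomial (xy (2 * m + 1) (2 * (k - m) + 1)) ((k.choose m : ℕ) : K) := by
  rw [F, add_pow, Finset.mul_sum]
  refine Finset.sum_congr rfl fun m _ => ?_
  rw [monomial_xy, map_natCast]; ring

/-- `x^{2k} · y · (1 + y²)^k`: the `x`-chart transform (`= x^{2k}·y·(1+y)^{2k}`). [folklore] -/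
def G (k : ℕ) : MvPolynomial (Fin 4) K := X 0 ^ (2 * k) * X 1 * (1 + X 1 ^ 2) ^ k

/-- `G_k = Σ_{m ≤ k} C(k,m) · x^{2k} y^{2(k−m)+1}`. [folklore] -/
theorem G_eq_sum (k : ℕ) :
    (G k : MvPolynomial (Fin 4) K) =
      ∑ m ∈ range (k + 1), monomial (xy (2 * k) (2 * (k - m) + 1)) ((k.choose m : ℕ) : K) := by
  rw [G, add_pow, Finset.mul_sum]
  refine Finset.sum_congr rfl fun m _ => ?_
  rw [monomial_xy, map_natCast]; ring

/-- the index `m` is recovered from the exponent. [folklore] -/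
private theorem xy_inj_left {m m' k : ℕ} (h : xy (2 * m + 1) (2 * (k - m) + 1) = xy (2 * m' + 1) (2 * (k - m') + 1)) :
    m = m' := by
  have := congrArg (· 0) h; simp at this; omega

/-- the coefficient of `x^{2m+1} y^{2(k−m)+1}` in `F_k` is `C(k,m)`. [folklore] -/
theorem coeff_F (k m : ℕ) (hm : m ≤ k) :
    coeff (xy (2 * m + 1) (2 * (k - m) + 1)) (F K k) = ((k.choose m : ℕ) : K) := by
  classical
  rw [F_eq_sum, coeff_sum, Finset.sum_eq_single m]
  · rw [coeff_monomial, if_pos rfl]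
  · intro m' _ hne; rw [coeff_monomial, if_neg]; exact fun h => hne (xy_inj_left h)
  · intro h; exact absurd (Finset.mem_range.mpr (by omega)) h

/-- every monomial of `F_k` is some `x^{2m+1} y^{2(k−m)+1}`, `m ≤ k`. [folklore] -/
theorem exists_of_mem_support_F {k : ℕ} {d : Fin 4 →₀ ℕ} (hd : d ∈ (F K k).support) :
    ∃ m ≤ k, d = xy (2 * m + 1) (2 * (k - m) + 1) := by
  classical
  rw [F_eq_sum] at hd
  obtain ⟨m, hm, -, h⟩ := PointBlowup.exists_of_mem_support_sum_monomial _ _ _ hd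
  exact ⟨m, by have := Finset.mem_range.mp hm; omega, h.symm⟩

/-- the two extreme monomials `x y^{2k+1}` and `x^{2k+1} y` occur with coefficient `1`. [folklore] -/
theorem coeff_F_zero (k : ℕ) : coeff (xy 1 (2 * k + 1)) (F K k) = 1 := by
  have := coeff_F (K := K) k 0 (Nat.zero_le k)
  simp only [mul_zero, zero_add, Nat.sub_zero, Nat.choose_zero_right, Nat.cast_one] at this
  exact this
/-- see `coeff_F_zero`. [folklore] -/
theorem coeff_F_top (k : ℕ) : coeff (xy (2 * k + 1) 1) (F K k) = 1 := by
  have := coeff_F (K := K) k k le_rfl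
  simp only [Nat.sub_self, mul_zero, zero_add, Nat.choose_self, Nat.cast_one] at this
  exact this

/-- `F_k ≠ 0`. [folklore] -/
theorem F_ne_zero (k : ℕ) : F K k ≠ 0 := fun h => by
  have := coeff_F_zero (K := K) k; rw [h, coeff_zero] at this; exact zero_ne_one this

/-! ## 2. The state, its shade, the centre -/

/-- the plane centre `V(z, x, y)`: `S = {x, y}`. [folklore] -/
def S : Finset (Fin 4) := {0, 1}

/-- `Σ_{S} d = d_x + d_y`. [folklore] -/
theorem degIn_S (d : Fin 4 →₀ ℕ) : degIn S d = d 0 + d 1 := degIn_pair (by decide) d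

variable (K) in
/-- the antelope state `a k = (F_k, (x ↦ 1, y ↦ 1), {x, y})`. [folklore] -/
def a (k : ℕ) : State K := ⟨F K k, xy 1 1, S⟩

/-- `ord_{(x,y)} F_k = 2k + 2` (every monomial has `S`-degree `2k + 2`). [folklore] -/
theorem ordAlong_S_F (k : ℕ) : ordAlong S (F K k) = ((2 * k + 2 : ℕ) : ℕ∞) := by
  apply le_antisymm
  · have := ordAlong_le_of_coeff_ne_zero (S := S) (d := xy 1 (2 * k + 1)) (F := F K k)
      (by rw [coeff_F_zero]; exact one_ne_zero)
    rw [degIn_S] at this; simp at this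
    exact le_trans this (by exact_mod_cast (by omega : 1 + (2 * k + 1) ≤ 2 * k + 2))
  · refine le_ordAlong_of_forall fun d hd => ?_
    obtain ⟨m, hm, rfl⟩ := exists_of_mem_support_F hd
    rw [degIn_S]; simp; omega

/-- `ord₀ F_k = 2k + 2`. [folklore] -/
theorem ordZero_F (k : ℕ) : ordZero (F K k) = ((2 * k + 2 : ℕ) : ℕ∞) := by
  rw [← ordAlong_univ]
  apply le_antisymm
  · have := ordAlong_le_of_coeff_ne_zero (S := Finset.univ) (d := xy 1 (2 * k + 1)) (F := F K k)
      (by rw [coeff_F_zero]; exact one_ne_zero)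
    rw [degIn_univ, degree_xy] at this
    exact le_trans this (by exact_mod_cast (by omega : 1 + (2 * k + 1) ≤ 2 * k + 2))
  · refine le_ordAlong_of_forall fun d hd => ?_
    obtain ⟨m, hm, rfl⟩ := exists_of_mem_support_F hd
    rw [degIn_univ, degree_xy]; omega

/-- shade `2k` at the antelope. [folklore] -/
theorem shade_a (k : ℕ) : (a K k).shade = ((2 * k : ℕ) : ℕ∞) := by
  show ordZero (F K k) - ((xy 1 1).degree : ℕ∞) = _
  rw [ordZero_F, degree_xy, ← ENat.coe_sub]; rfl

/-- combinatorial core: a coordinate set on which both extreme monomials have `S'`-degree `≥ 2` contains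
`x` and `y`. [folklore] -/
private theorem two_le_card {k : ℕ} (S' : Finset (Fin 4))
    (h0 : 2 ≤ ∑ i ∈ S', (![1, 2 * k + 1, 0, 0] : Fin 4 → ℕ) i)
    (h1 : 2 ≤ ∑ i ∈ S', (![2 * k + 1, 1, 0, 0] : Fin 4 → ℕ) i) : 2 ≤ S'.card := by
  classical
  have hy : (1 : Fin 4) ∈ S' := by
    by_contra hy
    have : ∑ i ∈ S', (![1, 2 * k + 1, 0, 0] : Fin 4 → ℕ) i ≤ ∑ i ∈ S', (![1, 0, 0, 0] : Fin 4 → ℕ) i :=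
      Finset.sum_le_sum fun i hi => by
        have : i ≠ 1 := fun h => hy (h ▸ hi)
        fin_cases i <;> simp_all
    have h' : ∑ i ∈ S', (![1, 0, 0, 0] : Fin 4 → ℕ) i ≤ ∑ i : Fin 4, (![1, 0, 0, 0] : Fin 4 → ℕ) i :=
      Finset.sum_le_sum_of_subset (Finset.subset_univ _)
    rw [Fin.sum_univ_four] at h'; simp at h'; omega
  have hx : (0 : Fin 4) ∈ S' := by
    by_contra hx
    have : ∑ i ∈ S', (![2 * k + 1, 1, 0, 0] : Fin 4 → ℕ) i ≤ ∑ i ∈ S', (![0, 1, 0, 0] : Fin 4 → ℕ) i :=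
      Finset.sum_le_sum fun i hi => by
        have : i ≠ 0 := fun h => hx (h ▸ hi)
        fin_cases i <;> simp_all
    have h' : ∑ i ∈ S', (![0, 1, 0, 0] : Fin 4 → ℕ) i ≤ ∑ i : Fin 4, (![0, 1, 0, 0] : Fin 4 → ℕ) i :=
      Finset.sum_le_sum_of_subset (Finset.subset_univ _)
    rw [Fin.sum_univ_four] at h'; simp at h'; omega
  calc 2 = ({0, 1} : Finset (Fin 4)).card := by decide
    _ ≤ S'.card := Finset.card_le_card (by
        intro i hi; simp only [Finset.mem_insert, Finset.mem_singleton] at hi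
        rcases hi with rfl | rfl <;> assumption)

/-- **`V(z, x, y)` is a MODE-1h centre of `a k`** (Hironaka-permissible; no hyperplane is). [folklore] -/
theorem isMode1hCentre_a (k : ℕ) : IsMode1hCentre 2 S (a K k).F := by
  refine ⟨⟨⟨0, by simp [S]⟩, ?_⟩, fun S' hS' => ?_⟩
  · show (2 : ℕ∞) ≤ ordAlong S (F K k)
    rw [ordAlong_S_F]; exact_mod_cast (by omega : 2 ≤ 2 * k + 2)
  · have h0 := le_trans hS'.2 (ordAlong_le_of_coeff_ne_zero (S := S') (F := F K k)
      (d := xy 1 (2 * k + 1)) (by rw [coeff_F_zero]; exact one_ne_zero))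
    have h1 := le_trans hS'.2 (ordAlong_le_of_coeff_ne_zero (S := S') (F := F K k)
      (d := xy (2 * k + 1) 1) (by rw [coeff_F_top]; exact one_ne_zero))
    rw [show S.card = 2 by decide]
    have h0' : 2 ≤ degIn S' (xy 1 (2 * k + 1)) := by exact_mod_cast h0
    have h1' : 2 ≤ degIn S' (xy (2 * k + 1) 1) := by exact_mod_cast h1
    simp only [degIn, xy_apply] at h0' h1'
    exact two_le_card S' h0' h1'

/-- **condition (2) holds** at `a k` for `V(z,x,y)`: `(1 + 1) + 2k ≤ 2k + 2` — eclass C1. [folklore] -/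
theorem perm2_a (k : ℕ) : Perm2 S (a K k) := by
  show (degIn S (xy 1 1) : ℕ∞) + (a K k).shade ≤ ordAlong S (F K k)
  rw [shade_a, ordAlong_S_F, degIn_S]; simp
  exact_mod_cast (by omega : 1 + 1 + 2 * k ≤ 2 * k + 2)

/-! ## 3. The step at the point `y = 1` of the `x`-chart -/

/-- the point `y = 1` of the `x`-chart. [folklore] -/
def b : Fin 4 → K := ![0, 1, 0, 0]

/-- chart law: `x^{2m+1} y^{β} ↦ x^{2k} y^{β}` (all monomials have `S`-degree `2k + 2`). [folklore] -/
theorem chartExponent_xy (k m : ℕ) (hm : m ≤ k) :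
    chartExponent 2 S 0 (xy (2 * m + 1) (2 * (k - m) + 1)) = xy (2 * k) (2 * (k - m) + 1) := by
  rw [chartExponent_eq_iff, degIn_S]
  refine ⟨by simp; omega, fun i hi => ?_⟩; fin_cases i <;> simp_all

/-- **the `x`-chart transform is `G_k = x^{2k}·y·(1+y²)^k`** (dehomogenisation). [folklore] -/
theorem chartTransform_F (k : ℕ) : chartTransform 2 S 0 (F K k) = G k := by
  classical
  rw [F_eq_sum, chartTransform_sum, G_eq_sum]
  refine Finset.sum_congr rfl fun m hm => ?_
  rw [chartTransform_monomial, chartExponent_xy k m (by have := Finset.mem_range.mp hm; omega)]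

/-- **the translated transform** at `y = 1`: `x^{2k}(y+1)(1+(y+1)²)^k = x^{2k}y^{2k+1} + x^{2k}y^{2k}`
in characteristic `2`. [folklore] -/
theorem pointTransform_a [CharP K 2] [DecidableEq K] (k : ℕ) :
    pointTransform 2 S 0 b (a K k) = monomial (xy (2 * k) (2 * k + 1)) 1 + monomial (xy (2 * k) (2 * k)) 1 := by
  have h2 : (2 : MvPolynomial (Fin 4) K) = 0 := by
    have := CharP.cast_eq_zero (MvPolynomial (Fin 4) K) 2; exact_mod_cast this
  have hsq : (1 + (X 1 + 1) ^ 2 : MvPolynomial (Fin 4) K) = X 1 ^ 2 := by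
    linear_combination (X 1 + 1) * h2
  rw [pointTransform, show (a K k).F = F K k from rfl, chartTransform_F, G]
  simp only [PointBlowup.translate, map_mul, map_pow, map_add, map_one, aeval_X, b,
    Matrix.cons_val_zero, Matrix.cons_val_one, map_zero, add_zero]
  rw [hsq, monomial_xy, monomial_xy, C_1]
  ring

/-- `F' = x^{2k} y^{2k+1}` after cleaning (the square `x^{2k}y^{2k}` is deleted). [folklore] -/
theorem step_F [CharP K 2] [DecidableEq K] (k : ℕ) :
    deletePthPowers 2 (pointTransform 2 S 0 b (a K k)) = monomial (xy (2 * k) (2 * k + 1)) 1 := by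
  classical
  have hodd : ¬ IsPthPowerExponent 2 (xy (2 * k) (2 * k + 1)) := fun h => by
    have := (isPthPowerExponent_iff 2 _).mp h 1; simp at this
  have heven : IsPthPowerExponent 2 (xy (2 * k) (2 * k)) := (isPthPowerExponent_iff 2 _).mpr fun i => by
    fin_cases i <;> simp
  rw [pointTransform_a, deletePthPowers_add, deletePthPowers_monomial, deletePthPowers_monomial, if_neg hodd,
    if_pos heven, add_zero]

variable (K) in
/-- the kangaroo state `k_state k = (x^{2k} y^{2k+1}, (x ↦ 2k), {x})`. [folklore] -/
def kState (k : ℕ) : State K := ⟨monomial (xy (2 * k) (2 * k + 1)) 1, Finsupp.single 0 (2 * k), {0}⟩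

/-- **the step**: `a k ⟶ kState k` at the point `y = 1` of the `x`-chart (`y` lost, `x ↦ 2k`). [folklore] -/
theorem step_a [CharP K 2] [DecidableEq K] (k : ℕ) : CentreBlowup.step 2 S 0 b (a K k) = kState K k := by
  have hr : newMult 2 S 0 b (a K k) = Finsupp.single 0 (2 * k) := by
    unfold newMult
    rw [show (a K k).F = F K k from rfl, ordAlong_S_F, ENat.toNat_coe, show (a K k).r = xy 1 1 from rfl]
    ext i
    rw [Finsupp.update_apply, Finsupp.filter_apply, Finsupp.single_apply]
    fin_cases i <;> simp [b]
  have he : newExc 0 b (a K k) = ({0} : Finset (Fin 4)) := by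
    unfold newExc; rw [show (a K k).exc = S from rfl, S]; ext i; fin_cases i <;> simp [b]
  unfold CentreBlowup.step
  rw [step_F, hr, he]; rfl

/-- the point `y = 1` is a `2`-fold point (both monomials of the transform have degree `≥ 4k ≥ 2`). [folklore] -/
theorem isEquimultiplePoint_a [CharP K 2] [DecidableEq K] {k : ℕ} (hk : 1 ≤ k) :
    IsEquimultiplePoint 2 S 0 b (a K k) := by
  intro d _ hd
  rw [pointTransform_a, coeff_add, coeff_monomial, coeff_monomial, if_neg, if_neg, add_zero]
  · intro h; rw [← h, degree_xy] at hd; omega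
  · intro h; rw [← h, degree_xy] at hd; omega

/-- shade `2k + 1` at the kangaroo state. [folklore] -/
theorem shade_kState (k : ℕ) : (kState K k).shade = ((2 * k + 1 : ℕ) : ℕ∞) := by
  show ordZero (monomial (xy (2 * k) (2 * k + 1)) (1 : K)) - ((Finsupp.single (0 : Fin 4) (2 * k)).degree : ℕ∞) = _
  rw [ordZero_monomial _ one_ne_zero, degree_xy, Finsupp.degree_single, ← ENat.coe_sub]
  congr 1; omega

/-! ## 4. The edge and its flags, for every `k ≥ 1` -/

/-- `a k ⟶ kState k` is an edge above the plane centre. [folklore] -/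
theorem edge_a [CharP K 2] [DecidableEq K] {k : ℕ} (hk : 1 ≤ k) : Edge 2 S (a K k) (kState K k) :=
  ⟨0, b, by simp [S], rfl, isEquimultiplePoint_a hk, by
    rw [step_a]; exact (MvPolynomial.monomial_eq_zero).not.mpr one_ne_zero, (step_a k).symm⟩

/-- **it is a MODE-1h step …** [folklore] -/
theorem step1h_a [CharP K 2] [DecidableEq K] {k : ℕ} (hk : 1 ≤ k) : Step1h 2 (a K k) (kState K k) :=
  ⟨S, isMode1hCentre_a k, edge_a hk⟩

/-- **… and an HP-permissible ((1) ∧ (2)) step: kangaroo-class, eclass C1.** [folklore] -/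
theorem stepHP_a [CharP K 2] [DecidableEq K] {k : ℕ} (hk : 1 ≤ k) : StepHP 2 (a K k) (kState K k) :=
  ⟨S, (isMode1hCentre_a k).1, perm2_a k, edge_a hk⟩

/-- **RISE:d `2k → 2k + 1`.** [folklore] -/
theorem riseD_a (k : ℕ) : RiseD (a K k) (kState K k) := by
  show (a K k).shade < (kState K k).shade
  rw [shade_a, shade_kState]; exact_mod_cast (by omega : 2 * k < 2 * k + 1)

end AntelopeFamily

open AntelopeFamily in
/-- **Z34 ‖ K, parametric.**  For every `k ≥ 1` and every field `K` of characteristic `2`, the antelope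
cylinder `(x·y·(x+y)^{2k}, (1,1), {x,y})` of shade `2k` has a kangaroo-class edge under MODE 1h — the
plane `V(z,x,y)` (also HP-permissible, eclass C1), `x`-chart, point `y = 1` — on which the shade rises
to `2k + 1` (Moh's `+1`).  The shape class of EVERY kangaroo-class rise observed by the census at
`L = 6` on `S-1a ∪ S-1x` (printed surface kangaroo × 𝔸²); nothing about resolution of singularities.
[folklore] -/
theorem antelope_family_rise (K : Type) [Field K] [CharP K 2] [DecidableEq K] {k : ℕ} (hk : 1 ≤ k) :
    Step1h 2 (a K k) (kState K k) ∧ StepHP 2 (a K k) (kState K k) ∧ RiseD (a K k) (kState K k) ∧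
      (a K k).shade = ((2 * k : ℕ) : ℕ∞) ∧ (kState K k).shade = ((2 * k + 1 : ℕ) : ℕ∞) :=
  ⟨step1h_a hk, stepHP_a hk, riseD_a k, shade_a k, shade_kState k⟩

open AntelopeFamily in
/-- In particular, for every `k ≥ 1` there is a MODE-1h kangaroo-class rise of size `+1` from shade
`2k` in class (4,1) over `𝔽₂`: the census' kangaroo class is realised at EVERY even shade. [folklore] -/
theorem exists_stepHP_riseD_of_shade (k : ℕ) (hk : 1 ≤ k) :
    ∃ s s' : State (ZMod 2), StepHP 2 s s' ∧ Step1h 2 s s' ∧ RiseD s s' ∧ s.shade = ((2 * k : ℕ) : ℕ∞) :=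
  ⟨a (ZMod 2) k, kState (ZMod 2) k, stepHP_a hk, step1h_a hk, riseD_a k, shade_a k⟩

end Summit.ResolutionOfSingularities.ResolutionOfSingularities.Theorems.PIDim4

end
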